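import Summits.AtomisticToContinuum.Crystallization.Theses.PerronTransitivity
import Literature.MathematicalPhysics.StatisticalMechanics.Yuhjtman2015

/-!
# Negative knowledge for crux `PerronTransitivity.NoFractionalGain` (K*, stmt-AtomisticToContinuum-15098):
# `c ≥ 0` stays load-bearing under the line's `73/100`-separation (modulo Yuhjtman's stability bound)

Refuter vetting (crux disprover, `--supports stmt-AtomisticToContinuum-15098`).  `LoadBearing.false_without_nonneg`
kills the sign-free form of K* with a dipole at distance `1/8`, using only the crude floor `E* ≥ −2³²/12`.  The
line `merge-perron` works on `73/100`-separated configurations (`stub_copositiveKepler`, `c ≥ 0`) and once carried a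
SIGN-FREE heart (`stub_perronKepler`, rev. 2, on `2^{-1/6}`-separated sets).  This file locates the sign threshold:

* `iInf_ge_of_stability` — Yuhjtman's certified stability constant (`Yuhjtman2015_stabilityConstant`, a NAMED FACT of
  the tree: `E_LJ(x) ≥ −(14.316/12)·N`) gives `E* ≥ −14.316/12 ≈ −1.193` through the proved limit `E(N)/N → E*`
  (`crysEnergyLimit`).
* `signed_false_on_separated_of_stability` — modulo that fact, K* with `c ≥ 0` deleted is FALSE even on
  `73/100`-separated injective configurations: the dipole `c = (1, −1)` at distance `73/100` has form
  `−2·V_LJ(0.73) = −5.07… < −4.772 ≤ 4E*`.  (With the true `E* ≈ −0.7176` the sign-free form fails exactly for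
  separations `δ < V_LJ⁻¹(2|E*|) ≈ 0.758` and is equivalent to K* on `2^{-1/6}`-separated sets, where the kernel
  `−V_LJ` is entrywise non-negative and the Perron root is the operator norm.)
So on the line's separation class the copositive restriction is not removable.  All `[folklore]`.
-/

noncomputable section

namespace Summit.AtomisticToContinuum.Crystallization.Theorems.NoFractionalGain.Negative.SignedSeparated

open Literature.MathematicalPhysics.StatisticalMechanics
open Summit.AtomisticToContinuum.Crystallization.Theorems.ChargedEnergyGapNegative (eStar crysEnergyLimit)
open scoped BigOperators
open Filter

/-- **`E* ≥ −14.316/12` modulo Yuhjtman's stability bound** (`E(N)/N ≥ −14.316/12` for all `N ≥ 1`, and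
`E(N)/N → E*`). [cite: Yuhjtman2015, Thm. 9] -/
theorem iInf_ge_of_stability (hY : Yuhjtman2015_stabilityConstant) :
    -(14.316 / 12 : ℝ) ≤ ⨅ Q : PeriodicConfiguration 3, Q.energyPerParticle lennardJones := by
  refine ge_of_tendsto crysEnergyLimit (eventually_atTop.2 ⟨1, fun N hN => ?_⟩)
  have hNr : (0 : ℝ) < N := by exact_mod_cast hN
  rw [le_div_iff₀ hNr]
  have h := hY.groundStateEnergy_ge N
  linarith

/-- The value `V_LJ(73/100)`. [folklore] -/
theorem lennardJones_073 :
    lennardJones (73 / 100) = (1 / 12) * (100 / 73 : ℝ) ^ 12 - (1 / 6) * (100 / 73 : ℝ) ^ 6 := by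
  simp [lennardJones]

/-- **Sign-free K* is false on `73/100`-separated sets, modulo Yuhjtman's stability bound**: the dipole
`c = (1, −1)` on two points at distance `73/100`. [cite: Yuhjtman2015, Thm. 9] -/
theorem signed_false_on_separated_of_stability (hY : Yuhjtman2015_stabilityConstant) :
    ¬ (∀ (N : ℕ) (x : Fin N → EuclideanSpace ℝ (Fin 3)), Function.Injective x →
        (∀ i j, i ≠ j → (73 : ℝ) / 100 ≤ dist (x i) (x j)) → ∀ c : Fin N → ℝ,
        2 * (⨅ Q : PeriodicConfiguration 3, Q.energyPerParticle lennardJones) * ∑ i, c i ^ 2 ≤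
          ∑ i, ∑ j ∈ Finset.univ.erase i, c i * c j * lennardJones (dist (x i) (x j))) := by
  intro h
  set p : EuclideanSpace ℝ (Fin 3) := EuclideanSpace.single 0 (73 / 100 : ℝ) with hp
  have hp0 : p ≠ 0 := by
    intro h0
    have := congrArg (fun v : EuclideanSpace ℝ (Fin 3) => v 0) h0
    simp [hp] at this
  have hnorm : ‖p‖ = 73 / 100 := by
    rw [hp]; simp
  let x : Fin 2 → EuclideanSpace ℝ (Fin 3) := ![p, 0]
  have hx : Function.Injective x := by
    intro i j hij
    fin_cases i <;> fin_cases j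
    · rfl
    · simp [x] at hij
      exact absurd hij hp0
    · simp [x] at hij
      exact absurd hij.symm hp0
    · rfl
  have h01 : dist (x 0) (x 1) = 73 / 100 := by simp [x, hnorm]
  have h10 : dist (x 1) (x 0) = 73 / 100 := by rw [dist_comm]; exact h01
  have hsep : ∀ i j : Fin 2, i ≠ j → (73 : ℝ) / 100 ≤ dist (x i) (x j) := by
    intro i j hij
    fin_cases i <;> fin_cases j
    · exact absurd rfl hij
    · exact h01.symm.le
    · exact h10.symm.le
    · exact absurd rfl hij
  have key := h 2 x hx hsep ![1, -1]
  have hsum : ∑ i : Fin 2, ∑ j ∈ Finset.univ.erase i,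
      (![1, -1] : Fin 2 → ℝ) i * (![1, -1] : Fin 2 → ℝ) j * lennardJones (dist (x i) (x j)) =
        -2 * lennardJones (73 / 100) := by
    rw [Fin.sum_univ_two]
    have e0 : (Finset.univ : Finset (Fin 2)).erase 0 = {1} := by decide
    have e1 : (Finset.univ : Finset (Fin 2)).erase 1 = {0} := by decide
    rw [e0, e1, Finset.sum_singleton, Finset.sum_singleton, h01, h10]
    simp; ring
  have hsq : ∑ i : Fin 2, (![1, -1] : Fin 2 → ℝ) i ^ 2 = 2 := by
    rw [Fin.sum_univ_two]; simp; norm_num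
  rw [hsum, hsq, lennardJones_073] at key
  have hfloor := iInf_ge_of_stability hY
  nlinarith

end Summit.AtomisticToContinuum.Crystallization.Theorems.NoFractionalGain.Negative.SignedSeparated

end
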